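import Literature.AlgebraicGeometry.Hu2025.Statements.S07GammaSchemes.R109bFTransforms
import Mathlib.Algebra.GroupWithZero.NonZeroDivisors
import Mathlib.RingTheory.Ideal.Quotient.Basic
import Mathlib.RingTheory.Ideal.Colon
import Mathlib.RingTheory.Ideal.Maps
import HarnessLib

/-!
# Hu 2025 (arXiv:2507.21400v1) §7.2–§7.4, item (2) «the induced morphism Z̃† → Z_Γ is birational» — KERNEL SUPPORT for the
# OURS ring-level vocabulary `IsBirationalHom` of row 109 (file `R109bFTransforms.lean`): identity and composition

**Honest framing (D-0012/D-0089).** Elementary algebra about OUR typed predicate `IsBirationalHom f` («`f` injective and every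
element of the target is a fraction `f b / f b'` with `f b'` a non-zero-divisor»), used by `GammaTransformChart.Birational`,
`Lem7_3_2`, `Lem7_4_2`, `Lem7_5_2`, `Cor7_6_birational`; the composition lemma is the algebra behind C62L78–L80 («Z̃†_{ϑ[k],Γ} →
Z̃†_{ϑ[k−1],Γ} → Z_Γ is birational») and C58L16–L21 / C58L40. Nothing of [Hu2025] (arXiv:2507.21400v1, `paper:arxiv-2507.21400`,
UNREFEREED, under adjudication at rung M-Hu-min of the campaign `res-hironaka`) is asserted. Provenance: res-type-016 (typer of
record of row 109).
-/

namespace Literature.AlgebraicGeometry.Hu2025.Statements.S07GammaSchemes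

open scoped nonZeroDivisors

namespace IsBirationalHom

variable {B C D : Type*} [CommRing B] [CommRing C] [CommRing D]

/-- The identity is birational (used at the induction base `k = 0`, C57L147 «Z_{𝔉[0],Γ} = Z†_{𝔉[0],Γ} := Z_Γ»).
[cite: Hu2025, Lem. 7.3 (2) C57L131–L133 / proof C57L147; p.130 (unrefereed manuscript under adjudication — kernel support over the typed OURS vocabulary, nothing of the manuscript asserted)] -/
theorem id : IsBirationalHom (RingHom.id B) :=
  ⟨fun _ _ h => h, fun c => ⟨c, 1, by simp, by simp⟩⟩

/-- An injective ring map into a domain carries non-zero-divisors of a nontrivial source to non-zero-divisors.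
[cite: Hu2025, Lem. 7.4 (2) proof C62L78–L80; p.139 (unrefereed manuscript under adjudication — kernel support, elementary algebra, nothing asserted)] -/
theorem map_mem_nonZeroDivisors [Nontrivial C] [IsDomain D] {g : C →+* D} (hg : Function.Injective g) {c : C}
    (hc : c ∈ C⁰) : g c ∈ D⁰ := by
  refine mem_nonZeroDivisors_of_ne_zero ?_
  intro h0
  exact nonZeroDivisors.ne_zero hc (hg (by simpa using h0))

/-- **Composition**: if `f : B → C` and `g : C → D` are birational (ring level) and `D` is a domain (with `C` nontrivial),
then `g ∘ f` is birational — the algebra of «Z̃†_{ϑ[k],Γ} → Z̃†_{ϑ[k−1],Γ} → Z_Γ is birational» (both arrows birational,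
all three schemes integral). [cite: Hu2025, Lem. 7.4 (2) proof C62L78–L80; p.139 (unrefereed manuscript under adjudication — kernel support over the typed OURS vocabulary, nothing of the manuscript asserted)] -/
theorem comp [Nontrivial C] [IsDomain D] {f : B →+* C} {g : C →+* D} (hf : IsBirationalHom f)
    (hg : IsBirationalHom g) : IsBirationalHom (g.comp f) := by
  refine ⟨hg.1.comp hf.1, fun d => ?_⟩
  obtain ⟨c, c', hgc', hd⟩ := hg.2 d
  obtain ⟨b₁, b₁', hb₁', hc⟩ := hf.2 c
  obtain ⟨b₂, b₂', hb₂', hc'⟩ := hf.2 c'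
  refine ⟨b₁ * b₂', b₂ * b₁', ?_, ?_⟩
  · rw [RingHom.comp_apply, map_mul, map_mul]
    refine Submonoid.mul_mem _ ?_ (map_mem_nonZeroDivisors hg.1 hb₁')
    rw [← hc', map_mul]
    exact Submonoid.mul_mem _ hgc' (map_mem_nonZeroDivisors hg.1 hb₂')
  · simp only [RingHom.comp_apply, map_mul]
    calc d * (g (f b₂) * g (f b₁')) = d * (g (c' * f b₂') * g (f b₁')) := by rw [hc']
      _ = (d * g c') * g (f b₂') * g (f b₁') := by rw [map_mul]; ring
      _ = g c * g (f b₂') * g (f b₁') := by rw [hd]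
      _ = g (c * f b₁') * g (f b₂') := by rw [map_mul]; ring
      _ = g (f b₁) * g (f b₂') := by rw [hc]

end IsBirationalHom

namespace GammaTransformChart

variable {V : Type*} {A : Type*} [CommRing A]

/-- At a chart where `Z† = Z` is the Γ-scheme itself (`zDagger` = the Γ-ideal and the induced map is the identity), item (2)
holds — the induction base C57L147. [cite: Hu2025, Lem. 7.3 (2) / proof C57L144–L153; p.130 (unrefereed manuscript under adjudication — kernel support over the typed carriers, nothing asserted)] -/
theorem birational_id (D : GammaTransformChart V A) : D.Birational (RingHom.id (A ⧸ D.zDagger)) :=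
  fun _ => IsBirationalHom.id

end GammaTransformChart

end Literature.AlgebraicGeometry.Hu2025.Statements.S07GammaSchemes

/-!
# Hu 2025 (arXiv:2507.21400v1) §7.3, the in-proof inference of Lemma 7.4 (1) (C60L71–L79, p.135; typed `C60L75` in row 109
# file c; JOINT J3 = G-H2): «We then take the proper transforms of these equations in 𝔙′ to obtain the corresponding equations in
# 𝔙 … Because Z̃_{ϑ[k],Γ} is the proper transform of Z̃_{ϑ[k−1],Γ}, this implies Lemma 7.4 (1)» — KERNEL SUPPORT: the EASY HALF

**Honest framing (D-0012/D-0089).** A kernel fact about the typed SHAPE of the inference (chart ideals `zIdeal` of the record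
`GammaTransformChart`, row 109 file b; strict transform = ζ-saturation `⨆ₙ (I′·A : ζⁿ)` as in `C60L53` / `C60L75` / row 106
`ChartStep.strictTransform`), taking no side on the manuscript [Hu2025] (arXiv:2507.21400v1, `paper:arxiv-2507.21400`,
UNREFEREED, under adjudication at rung M-Hu-min of the campaign `res-hironaka`). Provenance: res-type-016 (typer of record of
row 109). What is proved, for ANY ring map `π : A′ → A` (pull-back of the chart step), ANY `ζ : A` (exceptional variable),
ANY family `rels′` of equations of `Z̃′ ∩ 𝔙′` and ANY operation `pt` («proper transform of an equation») such that each
`pt (rels′ i)` is `π (rels′ i)` divided by a power of `ζ` (the shape of Def. 5.4: binomials divided by `ζ^{l_{φ,B}}`, general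
polynomials not divided at all, C35L19–L42):
* `saturation_mono` — the strict transform is monotone in the ideal; `colon_pow_mono`, `mem_saturation_of_mul_pow_mem` — the
  ζ-saturation is ζ-saturated; `mem_radical_saturation_of_eq` — radical membership propagates from `I′` to the strict transform
  along `π f′ = ζᵃ·f` (algebra of the item-(3) propagation C60L81–L102);
* `span_properTransforms_le_saturation` — the ideal generated by the transformed equations is CONTAINED in the strict
  transform `⨆ₙ ((I(Z̃′ ∩ 𝔙′)·A) : ζⁿ)`; i.e. (`span_properTransforms_le_zIdeal`) under the two hypotheses of `C60L75` the listed
  equations of Lemma 7.4 (1) DO vanish on `Z̃_{ϑ[k],Γ} ∩ 𝔙`.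
The REVERSE inclusion («is defined by» = equality) is the content the J3 adjudication examines; nothing here speaks to it.

## References
* [Hu2025] Y. Hu, arXiv:2507.21400v1 (2025), Def. 5.4 C35L13–L42 (p.80), Lem. 7.4 (1) C60L4–L17 and its proof C60L71–L79 (p.134–135)
  — loci of the typed definitions only (unrefereed manuscript under adjudication).
-/

namespace Literature.AlgebraicGeometry.Hu2025.Statements.S07GammaSchemes

variable {ι : Type*} {A A' : Type*} [CommRing A] [CommRing A']

/-- **The transformed equations lie in the strict transform.** If every `pt (rels′ i)` times a power of `ζ` is the pull-back
`π (rels′ i)` of an element of `I′`, then `⟨pt (rels′ i) : i⟩ ≤ ⨆ₙ ((I′·A) : ζⁿ)`.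
[cite: Hu2025, Def. 5.4 C35L19–L42 and Lem. 7.4 (1) proof C60L71–L79; p.80, p.135 (unrefereed manuscript under adjudication — kernel support over the typed shape, nothing of the manuscript asserted)] -/
theorem span_properTransforms_le_saturation (π : A' →+* A) (ζ : A) (pt : A' → A) (rels' : ι → A') (I' : Ideal A')
    (hrels : ∀ i, rels' i ∈ I') (hpt : ∀ i, ∃ n : ℕ, pt (rels' i) * ζ ^ n = π (rels' i)) :
    Ideal.span (Set.range (pt ∘ rels')) ≤ ⨆ n : ℕ, (I'.map π).colon ({ζ ^ n} : Set A) := by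
  rw [Ideal.span_le]
  rintro _ ⟨i, rfl⟩
  obtain ⟨n, hn⟩ := hpt i
  refine Submodule.mem_iSup_of_mem n ?_
  rw [Submodule.mem_colon_singleton, smul_eq_mul, Function.comp_apply, hn]
  exact Ideal.mem_map_of_mem π (hrels i)

/-- **The strict transform (ζ-saturation of the extension) is monotone in the ideal** — the algebra of the propagation step
of item (3) in the proper-transform case (C60L81–L102: «Z̃′ ∩ 𝔙′ ⊂ (y′ = 0) … as Z̃ is the proper transform of Z̃′, we obtain
Z̃ ∩ 𝔙 ⊂ (y = 0)»): a larger ideal upstairs has a larger strict transform.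
[cite: Hu2025, Lem. 7.4 (3) proof C60L81–L102; p.135 (unrefereed manuscript under adjudication — kernel support over the typed shape, nothing of the manuscript asserted)] -/
theorem saturation_mono (π : A' →+* A) (ζ : A) {I J : Ideal A'} (hIJ : I ≤ J) :
    (⨆ n : ℕ, (I.map π).colon ({ζ ^ n} : Set A)) ≤ ⨆ n : ℕ, (J.map π).colon ({ζ ^ n} : Set A) := by
  refine iSup_mono fun n => ?_
  intro x hx
  rw [Submodule.mem_colon_singleton] at hx ⊢
  exact Ideal.map_mono hIJ hx

/-- The colon ideals `((I′·A) : ζⁿ)` increase with `n`. [cite: Hu2025, Lem. 7.4 construction C60L47–L55; p.135 (unrefereed manuscript under adjudication — kernel support over the typed shape, elementary algebra, nothing asserted)] -/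
theorem colon_pow_mono (J : Ideal A) (ζ : A) : Monotone fun n : ℕ => J.colon ({ζ ^ n} : Set A) := by
  intro m n hmn x hx
  rw [Submodule.mem_colon_singleton, smul_eq_mul] at hx ⊢
  obtain ⟨k, rfl⟩ := Nat.exists_eq_add_of_le hmn
  rw [pow_add, ← mul_assoc]
  exact J.mul_mem_right _ hx

/-- **The ζ-saturation is ζ-saturated**: `x · ζᵐ ∈ ⨆ₙ ((I′·A) : ζⁿ) → x ∈ ⨆ₙ ((I′·A) : ζⁿ)` — the strict transform has no
component inside the exceptional divisor (algebraic form). [cite: Hu2025, Lem. 7.4 construction C60L47–L55 / proof C60L81–L102; p.135 (unrefereed manuscript under adjudication — kernel support over the typed shape, elementary algebra, nothing asserted)] -/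
theorem mem_saturation_of_mul_pow_mem (π : A' →+* A) (ζ : A) (I' : Ideal A') {x : A} {m : ℕ}
    (hx : x * ζ ^ m ∈ ⨆ n : ℕ, (I'.map π).colon ({ζ ^ n} : Set A)) :
    x ∈ ⨆ n : ℕ, (I'.map π).colon ({ζ ^ n} : Set A) := by
  have hdir : Directed (· ≤ ·) fun n : ℕ => (I'.map π).colon ({ζ ^ n} : Set A) :=
    (colon_pow_mono (I'.map π) ζ).directed_le
  obtain ⟨n, hn⟩ := (Submodule.mem_iSup_of_directed _ hdir).mp hx
  refine Submodule.mem_iSup_of_mem (m + n) ?_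
  rw [Submodule.mem_colon_singleton, smul_eq_mul] at hn ⊢
  simpa [pow_add, mul_assoc] using hn

/-- **Radical membership propagates to the strict transform** (the algebra of the item-(3) step C60L81–L102 «Z̃′ ∩ 𝔙′ ⊂ (y′ = 0)
… as Z̃ is the proper transform of Z̃′, we obtain Z̃ ∩ 𝔙 ⊂ (y = 0)»): if `π f′ = ζᵃ · f` (e.g. `f′ = y′`, `f = y` its proper
transform, `a ∈ {0, 1}`) and `f′ ∈ √I′`, then `f ∈ √(⨆ₙ ((I′·A) : ζⁿ))`.
[cite: Hu2025, Lem. 7.4 (3) proof C60L81–L102; p.135 (unrefereed manuscript under adjudication — kernel support over the typed shape, nothing of the manuscript asserted)] -/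
theorem mem_radical_saturation_of_eq (π : A' →+* A) (ζ : A) (I' : Ideal A') {f' : A'} {f : A} {a : ℕ}
    (hπ : π f' = ζ ^ a * f) (hf' : f' ∈ I'.radical) :
    f ∈ (⨆ n : ℕ, (I'.map π).colon ({ζ ^ n} : Set A)).radical := by
  obtain ⟨m, hm⟩ := hf'
  refine ⟨m, Submodule.mem_iSup_of_mem (a * m) ?_⟩
  rw [Submodule.mem_colon_singleton, smul_eq_mul]
  have h1 : π (f' ^ m) ∈ I'.map π := Ideal.mem_map_of_mem π hm
  rw [map_pow, hπ, mul_pow, ← pow_mul] at h1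
  simpa [mul_comm] using h1

namespace GammaTransformChart

variable {V V' : Type*}

/-- **Easy half of the `C60L75` shape.** Under the two hypotheses of the typed inference `C60L75` — `I(Z̃′ ∩ 𝔙′) = ⟨rels′⟩` and
`I(Z̃ ∩ 𝔙)` = the strict transform (ζ-saturation) of `I(Z̃′ ∩ 𝔙′)` — and for a Def.-5.4-shaped `pt` (each `pt (rels′ i)` is
`π (rels′ i)` divided by a power of `ζ`), the proper transforms of the equations vanish on `Z̃ ∩ 𝔙`:
`⟨pt ∘ rels′⟩ ≤ I(Z̃ ∩ 𝔙)`. (Equality — «is defined by» — is what joint J3 examines; not addressed here.)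
[cite: Hu2025, Lem. 7.4 (1) proof C60L71–L79; p.135 (unrefereed manuscript under adjudication — kernel support over the typed shape of the inference, nothing of the manuscript asserted)] -/
theorem span_properTransforms_le_zIdeal (π : A' →+* A) (ζ : A) (pt : A' → A) (rels' : ι → A')
    (D' : GammaTransformChart V' A') (D : GammaTransformChart V A)
    (h' : D'.zIdeal = Ideal.span (Set.range rels'))
    (h : D.zIdeal = ⨆ n : ℕ, (D'.zIdeal.map π).colon ({ζ ^ n} : Set A))
    (hpt : ∀ i, ∃ n : ℕ, pt (rels' i) * ζ ^ n = π (rels' i)) :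
    Ideal.span (Set.range (pt ∘ rels')) ≤ D.zIdeal := by
  rw [h]
  refine span_properTransforms_le_saturation π ζ pt rels' D'.zIdeal (fun i => ?_) hpt
  rw [h']
  exact Ideal.subset_span ⟨i, rfl⟩

end GammaTransformChart

end Literature.AlgebraicGeometry.Hu2025.Statements.S07GammaSchemes

/-!
# Hu 2025 (arXiv:2507.21400v1) §7.2–§7.3, FIRST BULLET of Lemmas 7.3 / 7.4 («there exists a closed subscheme Z̃ of 𝒱̃ with an
# induced morphism Z̃ → Z_Γ») along the two printed constructions — KERNEL SUPPORT over the typed carriers of row 109 (file b: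
# `GammaTransformChart.LiesOverGamma`, the construction shapes `C58L13` (pre-image ∩ coordinate hyperplanes) and the
# strict-transform shape of `C60L53`)

**Honest framing (D-0012/D-0089).** Kernel facts about TYPED shapes, taking no side on the manuscript [Hu2025] (arXiv:2507.21400v1,
`paper:arxiv-2507.21400`, UNREFEREED, under adjudication at rung M-Hu-min of the campaign `res-hironaka`); nothing of [Hu2025] is
asserted. Provenance: res-type-016 (typer of record of row 109). Content: the «induced morphism to Z_Γ» part of the first bullet
PROPAGATES along an induction step of either printed kind — if the chart ideal of the previous stage contains the image of
`I_{℘,Γ}` (under the structure map `base′ : 𝔽[x_u] → A′`), then so does (i) any ideal of the shape (7.3)/(7.10)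
`zIdeal = zIdeal′·A + (ideal of 𝒱 ∩ 𝔙) + (x_{(u,v)} : (u,v) ∈ Λ⁰)` (`liesOver_of_C58L13`) and (ii) the strict transform
`⨆ₙ ((zIdeal′·A) : ζⁿ)` (`liesOver_of_saturation`), under the composite structure map `ρ ∘ base′`. (The companion inequality
`vIdeal ≤ zIdeal` of `LiesOverGamma` is immediate in case (i) and is a hypothesis on the chart data in case (ii).)

## References
* [Hu2025] Y. Hu, arXiv:2507.21400v1 (2025), Lem. 7.3 first bullet C57L84–L89 with constructions (7.3) C58L8–L14 / (7.10)
  C59L61–L65 (p.129–133); Lem. 7.4 first bullet C59L152–L156 with construction C60L47–L55 (p.134–135) — loci of the typed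
  definitions only (unrefereed manuscript under adjudication).
-/

namespace Literature.AlgebraicGeometry.Hu2025.Statements.S07GammaSchemes

namespace GammaTransformChart

variable {V V' : Type*} {A A' R₀ : Type*} [CommRing A] [CommRing A'] [CommRing R₀] {T : Type*}

/-- **Step of kind (7.3)/(7.10)**: if `I_{℘,Γ}·A′ ≤ I(Z′ ∩ 𝔙′)` and the new chart ideal has the `C58L13` shape
`I(Z ∩ 𝔙) = I(Z′ ∩ 𝔙′)·A + I(𝒱 ∩ 𝔙) + (x_{(u,v)} : Λ⁰)` along `ρ : A′ → A`, then `Z ∩ 𝔙` lies over `Z_Γ` and inside `𝒱 ∩ 𝔙`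
for the composite structure map `ρ ∘ base′` (typed `LiesOverGamma`).
[cite: Hu2025, Lem. 7.3 first bullet C57L84–L89 with (7.3) C58L8–L14 / (7.10) C59L61–L65; p.129–133 (unrefereed manuscript under adjudication — kernel support over the typed shapes, nothing of the manuscript asserted)] -/
theorem liesOver_of_C58L13 (ρ : A' →+* A) (base' : R₀ →+* A') (gammaWp : Ideal R₀) (vIdeal : Ideal A) (xRho : T → A)
    (lambdaZero : Set T) (zIdeal' : Ideal A') (D : GammaTransformChart V A)
    (hprev : gammaWp.map base' ≤ zIdeal') (hcons : C58L13 ρ vIdeal xRho lambdaZero zIdeal' D.zIdeal) :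
    D.LiesOverGamma (ρ.comp base') gammaWp vIdeal := by
  have hz : D.zIdeal = zIdeal'.map ρ ⊔ vIdeal ⊔ Ideal.span (xRho '' lambdaZero) := hcons
  refine ⟨?_, ?_⟩
  · rw [hz]
    exact le_sup_of_le_left le_sup_right
  · rw [hz, ← Ideal.map_map]
    exact le_sup_of_le_left (le_sup_of_le_left (Ideal.map_mono hprev))

/-- The extension of an ideal lies below its ζ-saturation (`n = 0` term). [cite: Hu2025, Lem. 7.4 construction C60L47–L55; p.135 (unrefereed manuscript under adjudication — kernel support over the typed shape, elementary algebra, nothing asserted)] -/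
theorem map_le_saturation (π : A' →+* A) (ζ : A) (I' : Ideal A') :
    I'.map π ≤ ⨆ n : ℕ, (I'.map π).colon ({ζ ^ n} : Set A) := by
  refine le_trans ?_ (le_iSup _ 0)
  intro x hx
  rw [Submodule.mem_colon_singleton, pow_zero, smul_eq_mul, mul_one]
  exact hx

/-- **Step of the strict-transform kind (C60L53)**: if `I_{℘,Γ}·A′ ≤ I(Z̃′ ∩ 𝔙′)` and `I(Z̃ ∩ 𝔙)` is the ζ-saturation of
`I(Z̃′ ∩ 𝔙′)·A` along `π : A′ → A`, then `I_{℘,Γ}·A ≤ I(Z̃ ∩ 𝔙)` for the composite structure map; with the chart datum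
`I(𝒱̃ ∩ 𝔙) ≤ I(Z̃ ∩ 𝔙)` this is the typed `LiesOverGamma`.
[cite: Hu2025, Lem. 7.4 first bullet C59L152–L156 with construction C60L47–L55; p.134–135 (unrefereed manuscript under adjudication — kernel support over the typed shapes, nothing of the manuscript asserted)] -/
theorem liesOver_of_saturation (π : A' →+* A) (ζ : A) (base' : R₀ →+* A') (gammaWp : Ideal R₀) (vIdeal : Ideal A)
    (zIdeal' : Ideal A') (D : GammaTransformChart V A)
    (hprev : gammaWp.map base' ≤ zIdeal') (hsat : D.zIdeal = ⨆ n : ℕ, (zIdeal'.map π).colon ({ζ ^ n} : Set A))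
    (hv : vIdeal ≤ D.zIdeal) :
    D.LiesOverGamma (π.comp base') gammaWp vIdeal := by
  refine ⟨hv, ?_⟩
  rw [hsat, ← Ideal.map_map]
  exact le_trans (Ideal.map_mono hprev) (map_le_saturation π ζ zIdeal')

end GammaTransformChart

end Literature.AlgebraicGeometry.Hu2025.Statements.S07GammaSchemes

/-!
# Hu 2025 (arXiv:2507.21400v1) §7.3, Lemma 7.4 item (3) — the induction step in the PROPER-TRANSFORM case (C60L81–L102, p.135:
# «Suppose Z̃† ∩ 𝔙 ⊂ (y = 0) … then y cannot be the exceptional variable … hence y is the proper transform of some y′ … by (3)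
# at stage k−1 … as Z̃ is the proper transform of Z̃′ we obtain Z̃ ∩ 𝔙 ⊂ (y = 0)») — KERNEL SUPPORT: the step FOLLOWS from the
# typed shapes MODULO two explicit, named hypotheses (dominance of Z̃† → Z̃†′ and Z̃† ⊂ Z̃)

**Honest framing (D-0012/D-0089).** A kernel fact about the TYPED shapes of row 109 (file b: `GammaTransformChart.ContainedInIff`,
the strict-transform shape of `C60L53`), taking no side on the manuscript [Hu2025] (arXiv:2507.21400v1, `paper:arxiv-2507.21400`,
UNREFEREED, under adjudication at rung M-Hu-min of the campaign `res-hironaka`); nothing of [Hu2025] is asserted. Provenance: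
res-type-016 (typer of record of row 109). `containedInIff_step`: with
* `h3′` — item (3) at stage `k − 1` (only the direction «Z̃†′ ⊂ (y′=0) ⇒ Z̃′ ⊂ (y′=0)» is used),
* `hI`, `hD` — `I(Z̃ ∩ 𝔙)`, `I(Z̃† ∩ 𝔙)` are the ζ-saturations of the extensions of `I(Z̃′ ∩ 𝔙′)`, `I(Z̃†′ ∩ 𝔙′)` (the typed `C60L53`),
* `hle` — `Z̃† ∩ 𝔙 ⊂ Z̃ ∩ 𝔙` (`I(Z̃) ≤ I(Z̃†)`; in the text: a component),
* `hdom` — DOMINANCE of `Z̃† ∩ 𝔙 → Z̃†′ ∩ 𝔙′` in the algebraic form `π⁻¹ I(Z̃† ∩ 𝔙) ≤ √I(Z̃†′ ∩ 𝔙′)` (in the text: «Z̃† → Z̃†′ is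
  birational», C60L56–L58 / C62L78–L80),
* `hvars` — every variable of `𝔙` is either the exceptional `ζ` or satisfies `π y′ = ζᵃ · y` for a variable `y′` of `𝔙′` (the chart
  shape of Prop. 5.3, C34L146–L157: `y′_i ↦ ζ·y_i`, `y′ ↦ y`),
the typed item (3) holds at stage `k`. Which of these the manuscript establishes where is for the adjudication; the lemma only isolates
what the printed three-line argument uses.

## References
* [Hu2025] Y. Hu, arXiv:2507.21400v1 (2025), Lem. 7.4 (3) C60L21–L22 and its proof C60L81–L102 (p.135); Prop. 5.3 C34L146–L157 (p.80)
  — loci of the typed definitions only (unrefereed manuscript under adjudication).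
-/

namespace Literature.AlgebraicGeometry.Hu2025.Statements.S07GammaSchemes

namespace GammaTransformChart

variable {V V' : Type*} {A A' : Type*} [CommRing A] [CommRing A']

/-- The exceptional variable does not vanish identically on a NON-EMPTY strict transform: `ζ ∈ √(⨆ₙ ((J·A) : ζⁿ))` forces the
saturation to be `⊤` (C60L84–L86 «y can not be the exceptional variable … since Z̃† … is not contained in the exceptional divisor»).
[cite: Hu2025, Lem. 7.4 (3) proof C60L84–L86; p.135 (unrefereed manuscript under adjudication — kernel support over the typed shape, nothing of the manuscript asserted)] -/
theorem saturation_eq_top_of_exc_mem_radical (π : A' →+* A) (ζ : A) (J : Ideal A')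
    (h : ζ ∈ (⨆ n : ℕ, (J.map π).colon ({ζ ^ n} : Set A)).radical) :
    (⨆ n : ℕ, (J.map π).colon ({ζ ^ n} : Set A)) = ⊤ := by
  obtain ⟨m, hm⟩ := h
  rw [Ideal.eq_top_iff_one]
  exact mem_saturation_of_mul_pow_mem π ζ J (m := m) (by simpa using hm)

/-- **Item (3), induction step in the proper-transform case — FOLLOWS from the typed shapes MODULO the named hypotheses**
(`hdom` dominance of `Z̃† → Z̃†′`, `hle` `Z̃† ⊂ Z̃`, `hvars` the Prop.-5.3 chart shape); see the module docstring.
[cite: Hu2025, Lem. 7.4 (3) C60L21–L22 with proof C60L81–L102; p.135 (unrefereed manuscript under adjudication — kernel support over the typed shapes; the hypotheses are explicit and named, nothing of the manuscript asserted)] -/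
theorem containedInIff_step (π : A' →+* A) (ζ : A) (var' : V' → A') (var : V → A)
    (D' : GammaTransformChart V' A') (D : GammaTransformChart V A)
    (h3' : ∀ y', var' y' ∈ D'.zDagger.radical → var' y' ∈ D'.zIdeal.radical)
    (hI : D.zIdeal = ⨆ n : ℕ, (D'.zIdeal.map π).colon ({ζ ^ n} : Set A))
    (hD : D.zDagger = ⨆ n : ℕ, (D'.zDagger.map π).colon ({ζ ^ n} : Set A))
    (hle : D.zIdeal ≤ D.zDagger)
    (hdom : D.zDagger.comap π ≤ D'.zDagger.radical)
    (hvars : ∀ y, var y = ζ ∨ ∃ (y' : V') (a : ℕ), π (var' y') = ζ ^ a * var y) :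
    D.ContainedInIff var := by
  intro hne y
  constructor
  · intro hy
    rcases hvars y with hexc | ⟨y', a, hπ⟩
    · -- `y = ζ`: impossible on a non-empty strict transform
      exfalso
      apply hne
      rw [hD]
      apply saturation_eq_top_of_exc_mem_radical π ζ D'.zDagger
      rw [← hD, ← hexc]
      exact hy
    · -- `y` is the proper transform of `y′`
      have h1 : π (var' y') ∈ D.zDagger.radical := by
        rw [hπ]
        exact (D.zDagger.radical).mul_mem_left _ hy
      have h2 : var' y' ∈ D'.zDagger.radical := by
        obtain ⟨m, hm⟩ := h1
        have : var' y' ^ m ∈ D.zDagger.comap π := by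
          rw [Ideal.mem_comap, map_pow]
          exact hm
        exact Ideal.radical_idem D'.zDagger ▸ (Ideal.radical_mono hdom) ⟨m, this⟩
      have h3 : var' y' ∈ D'.zIdeal.radical := h3' y' h2
      rw [hI]
      exact mem_radical_saturation_of_eq π ζ D'.zIdeal hπ h3
  · intro hy
    exact Ideal.radical_mono hle hy

/-- An irreducible component contains the scheme's ideal: the typed `IsComponent` (`zDagger ∈ zIdeal.minimalPrimes` on a chart
meeting `Z̃†`) gives `I(Z̃ ∩ 𝔙) ≤ I(Z̃† ∩ 𝔙)`. [cite: Hu2025, Lem. 7.3 / 7.4 second bullet C57L91–L94 / C59L158–L161; p.129, p.134 (unrefereed manuscript under adjudication — kernel support over the typed carrier, nothing asserted)] -/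
theorem zIdeal_le_zDagger_of_isComponent (D : GammaTransformChart V A) (hC : D.IsComponent) (hne : D.zDagger ≠ ⊤) :
    D.zIdeal ≤ D.zDagger :=
  (hC hne).1.2

/-- **Item (3) step with `Z̃† ⊂ Z̃` supplied by the typed second bullet** (`IsComponent` at stage `k`) instead of the raw
inequality. [cite: Hu2025, Lem. 7.4 (3) C60L21–L22 with proof C60L81–L102; p.135 (unrefereed manuscript under adjudication — kernel support over the typed shapes; hypotheses explicit and named, nothing of the manuscript asserted)] -/
theorem containedInIff_step_of_isComponent (π : A' →+* A) (ζ : A) (var' : V' → A') (var : V → A)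
    (D' : GammaTransformChart V' A') (D : GammaTransformChart V A)
    (h3' : ∀ y', var' y' ∈ D'.zDagger.radical → var' y' ∈ D'.zIdeal.radical)
    (hI : D.zIdeal = ⨆ n : ℕ, (D'.zIdeal.map π).colon ({ζ ^ n} : Set A))
    (hD : D.zDagger = ⨆ n : ℕ, (D'.zDagger.map π).colon ({ζ ^ n} : Set A))
    (hC : D.IsComponent)
    (hdom : D.zDagger.comap π ≤ D'.zDagger.radical)
    (hvars : ∀ y, var y = ζ ∨ ∃ (y' : V') (a : ℕ), π (var' y') = ζ ^ a * var y) :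
    D.ContainedInIff var := by
  intro hne y
  exact containedInIff_step π ζ var' var D' D h3' hI hD (zIdeal_le_zDagger_of_isComponent D hC hne) hdom hvars hne y

/-- **Dominance from the two birationality items.** If `φ′ : R_Γ → A′/I(Z̃†′)` is birational (item (2) at stage k−1) and
`g ∘ φ′` is injective (e.g. `g ∘ φ′ = φ` = item (2) at stage k, injective part), where `g : A′/I(Z̃†′) → A/I(Z̃†)` is the map
induced by the chart step, then `g` is injective — i.e. `Z̃† → Z̃†′` is dominant. This discharges the `hdom` hypothesis of
`containedInIff_step` from printed data (items (2) at both stages + the factorisation «Z̃† → Z̃†′ → Z_Γ», C62L78–L80).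
[cite: Hu2025, Lem. 7.4 (2) C60L19 with proof C60L56–L58 / C62L78–L80; p.134–139 (unrefereed manuscript under adjudication — kernel support over the typed OURS vocabulary, nothing of the manuscript asserted)] -/
theorem _root_.Literature.AlgebraicGeometry.Hu2025.Statements.S07GammaSchemes.IsBirationalHom.injective_of_comp_injective
    {B C D : Type*} [CommRing B] [CommRing C] [CommRing D] {φ' : B →+* C} {g : C →+* D}
    (hφ' : IsBirationalHom φ') (h : Function.Injective (g.comp φ')) : Function.Injective g := by
  intro c₁ c₂ hc
  rw [← sub_eq_zero] at hc ⊢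
  set c := c₁ - c₂ with hcdef
  have hgc : g c = 0 := by rw [hcdef, map_sub]; exact hc
  obtain ⟨b, b', hb', hfrac⟩ := hφ'.2 c
  have hb0 : φ' b = 0 := by
    have : g (φ' b) = 0 := by rw [← hfrac, map_mul, hgc, zero_mul]
    have hb : b = 0 := h (by simpa using this)
    rw [hb, map_zero]
  have : c * φ' b' = 0 := by rw [hfrac, hb0]
  exact (mul_right_mem_nonZeroDivisors_eq_zero_iff hb').mp this

/-- If the induced map of quotients `A′/J′ → A/J` (from `π` with `J′·A ⊆ J`) is injective, then `π⁻¹ J ≤ J′` — the algebraic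
form of dominance used as `hdom` (with `J′ ≤ √J′`). [cite: Hu2025, Lem. 7.4 (3) proof C60L81–L102; p.135 (unrefereed manuscript under adjudication — kernel support, elementary algebra, nothing asserted)] -/
theorem comap_le_of_quotientMap_injective (π : A' →+* A) (J' : Ideal A') (J : Ideal A) (hJ : J' ≤ J.comap π)
    (hinj : Function.Injective (Ideal.quotientMap J π hJ)) : J.comap π ≤ J' := by
  intro x hx
  rw [Ideal.mem_comap] at hx
  have h0 : Ideal.quotientMap J π hJ (Ideal.Quotient.mk J' x) = 0 := by
    rw [Ideal.quotientMap_mk]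
    exact Ideal.Quotient.eq_zero_iff_mem.mpr hx
  have hx0 : Ideal.Quotient.mk J' x = 0 := hinj (by rw [h0, map_zero])
  exact Ideal.Quotient.eq_zero_iff_mem.mp hx0

end GammaTransformChart

end Literature.AlgebraicGeometry.Hu2025.Statements.S07GammaSchemes
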